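import Mathlib.Algebra.BigOperators.Fin
import Mathlib.Data.Finset.Lattice.Fold
import Mathlib.Data.Fintype.Prod
import Literature.Computability.Cryptography.EditDistFacts
import HarnessLib

/-!
# The Bringmann–Künnemann alignment gadget for Levenshtein distance on binary strings

Definitions, with their elementary bookkeeping, of the objects of K. Bringmann, M. Künnemann,
*Quadratic conditional lower bounds for string problems and dynamic time warping*, FOCS 2015
(arXiv:1502.01063), §3 (framework) and §5.2 (edit distance), specialised to the Levenshtein
distance `editDist` on `List Bool` (their `EDIT(c_subst)` with `c_subst = 1`, so `ρ = 2⌈1/c_subst⌉ = 2`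
and `β = 1 - c_subst/5 = 4/5`):

* §3, alignments: `IsAlignment` (a partial alignment `{(i₁,j₁),…,(i_k,j_k)}`, `i`'s and `j`'s
  strictly increasing), its cost `alignCost x y A = ∑_{(i,j) ∈ A} δ(xᵢ,yⱼ) + (m - |A|) · maxᵢⱼ δ(xᵢ,yⱼ)`
  (`maxDist`), and the cost of the structured alignment `{(Δ+1,1),…,(Δ+m,m)}`
  (`structuredCost`);
* §5.2, Lemma 5.2, the **coordinate values** `1ₓ = 11100`, `0ₓ = 10011`, `1_y = 00111`,
  `0_y = 11001` (`oneX`, `zeroX`, `oneY`, `zeroY`) with their edit distances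
  `δ(1ₓ,1_y) = 4 > δ(0ₓ,1_y) = δ(1ₓ,0_y) = δ(0ₓ,0_y) = 2` (**proved**, by evaluating the recursion)
  and equal types (length `5`, three ones);
* §5.2, Lemma 5.3, the **alignment gadget**: parameters `γ₁ = 10ρ(ℓₓ+ℓ_y) = 20(ℓₓ+ℓ_y)`,
  `γ₂ = 6ργ₁ + 5sₓ - ℓₓ = 239ℓₓ + 240ℓ_y + 5sₓ`, `γ₃ = 2γ₂`, `γ₄ = 4ργ₁ + ℓₓ = 8γ₁ + ℓₓ`
  (`Params.γ₁ … γ₄`, functions of the common type `(ℓₓ, sₓ)` of the `xᵢ` and the common length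
  `ℓ_y` of the `yⱼ`), the guarding `G(z) = (1^{γ₁} 0^{γ₁})² z (0^{γ₁} 1^{γ₁})²` (`Params.guard`),
  `x = G(x₁) 0^{γ₂} G(x₂) ⋯ 0^{γ₂} G(x_n)` (`Params.gadgetX`),
  `y = 0^{nγ₃} G(y₁) 0^{γ₂} ⋯ G(y_m) 0^{nγ₃}` (`Params.gadgetY`), and the offset
  `C = 2nγ₃ - β(n-m)(γ₄+γ₂) = 4nγ₂ - 4(n-m)(4γ₁+sₓ)` (`Params.C`; an integer because
  `γ₄ + γ₂ = 5(4γ₁ + sₓ)`);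
* §5.2, **Lemma 5.4 as a named fact** `alignmentGadget_editDist`: the construction realises an
  alignment gadget, i.e. `min_{A ∈ 𝒜_{n,m}} δ(A) ≤ editDist x y - C ≤ min_{A ∈ 𝒮_{n,m}} δ(A)`
  (Def. 3.1), stated as: every structured alignment bounds `editDist x y - C` from above, and some
  alignment bounds it from below.

## Scope of the named fact (read before use)

Lemma 5.4 is vendored with three explicit side conditions, all satisfied by the three
invocations of the gadget in the OV reduction of BK15 §3.1 (vector gadgets with `n = m = d+1`,
normalised vector gadgets with `(n, m) = (2, 1)`, the final strings with `(2n, n)`):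
`1 ≤ m ≤ n` (print: `m ≤ n`; for `m = 0` the bookkeeping identity
`|x(L^y)| + |x(R^y)| = (n-m)(γ₄+γ₂)` of the proof fails and so does the inequality), all `xᵢ` of
one type `(ℓₓ, sₓ)` and all `yⱼ` of one length `ℓ_y` (print: of one type), and `ℓₓ ≤ ℓ_y`. The
last condition is implicit in print: the proof of Claim 5.9 uses "`≥ |G(yᵢ)| - |x(G(yⱼ))| =
γ₄ - |x(G(yⱼ))|`", i.e. `|G(yⱼ)| = 4ργ₁ + ℓ_y ≥ γ₄ = 4ργ₁ + ℓₓ`; with the printed parameters the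
linear-combination step of that case needs `9ℓ_y ≥ 4ℓₓ`. In §3.1 the `y`-side strings are never
shorter than the `x`-side ones (coordinate level: both `5`; the two outer levels: the `y`-side
carries the padding `0^{nγ₃}`), so the restriction costs nothing downstream.

## What is not here

The proof of Lemma 5.4 (BK15 Facts 5.5–5.7 are in `Cryptography.EditDistFacts`; Lemmas 5.8–5.9
are the remaining work), and the OV reduction of §3.1 (coordinate/vector/normalised vector
gadgets, Claims 3.4–3.6, the threshold) — see `EditDistanceSETH.lean` for the plan.
-/

namespace Literature.Computability.FineGrained

open Cryptography

namespace BKGadget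

/-! ### Blocks of equal symbols -/

/-- `0^k` as a bit string. [folklore] -/
def zeros (k : ℕ) : List Bool := List.replicate k false

/-- `1^k` as a bit string. [folklore] -/
def ones (k : ℕ) : List Bool := List.replicate k true

/-- `|0^k| = k`. [folklore] -/
@[simp] theorem length_zeros (k : ℕ) : (zeros k).length = k := List.length_replicate

/-- `|1^k| = k`. [folklore] -/
@[simp] theorem length_ones (k : ℕ) : (ones k).length = k := List.length_replicate

/-- `0^k` has no ones. [folklore] -/
@[simp] theorem count_true_zeros (k : ℕ) : (zeros k).count true = 0 := by
  simp [zeros, List.count_replicate]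

/-- `1^k` has `k` ones. [folklore] -/
@[simp] theorem count_true_ones (k : ℕ) : (ones k).count true = k := by
  simp [ones]

/-! ### Coordinate values (BK15, Lemma 5.2) -/

/-- The coordinate value `1ₓ = 11100` (Bringmann–Künnemann, FOCS 2015, Lemma 5.2).
[cite: BringmannKunnemannFOCS2015, Lemma 5.2] -/
def oneX : List Bool := [true, true, true, false, false]

/-- The coordinate value `0ₓ = 10011` (BK15, Lemma 5.2). [cite: BringmannKunnemannFOCS2015, Lemma 5.2] -/
def zeroX : List Bool := [true, false, false, true, true]

/-- The coordinate value `1_y = 00111` (BK15, Lemma 5.2). [cite: BringmannKunnemannFOCS2015, Lemma 5.2] -/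
def oneY : List Bool := [false, false, true, true, true]

/-- The coordinate value `0_y = 11001` (BK15, Lemma 5.2). [cite: BringmannKunnemannFOCS2015, Lemma 5.2] -/
def zeroY : List Bool := [true, true, false, false, true]

/-- `δ(0ₓ, 0_y) = 2` (BK15, Lemma 5.2: `min{2, 2c_subst}` with `c_subst = 1`), by evaluating the
Wagner–Fischer recursion. [cite: BringmannKunnemannFOCS2015, Lemma 5.2] -/
theorem editDist_zeroX_zeroY : editDist zeroX zeroY = 2 := by
  simp [zeroX, zeroY, editDist_cons_cons]

/-- `δ(0ₓ, 1_y) = 2` (BK15, Lemma 5.2). [cite: BringmannKunnemannFOCS2015, Lemma 5.2] -/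
theorem editDist_zeroX_oneY : editDist zeroX oneY = 2 := by
  simp [zeroX, oneY, editDist_cons_cons]

/-- `δ(1ₓ, 0_y) = 2` (BK15, Lemma 5.2). [cite: BringmannKunnemannFOCS2015, Lemma 5.2] -/
theorem editDist_oneX_zeroY : editDist oneX zeroY = 2 := by
  simp [oneX, zeroY, editDist_cons_cons]

/-- `δ(1ₓ, 1_y) = 4` (BK15, Lemma 5.2: `min{4, 4c_subst}`), so
`δ(1ₓ,1_y) > δ(0ₓ,1_y) = δ(1ₓ,0_y) = δ(0ₓ,0_y)`: the four strings are coordinate values in the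
sense of BK15, Def. 3.2. [cite: BringmannKunnemannFOCS2015, Lemma 5.2] -/
theorem editDist_oneX_oneY : editDist oneX oneY = 4 := by
  simp [oneX, oneY, editDist_cons_cons]

/-- The `x`-side coordinate values have equal type: length `5` … [cite: BringmannKunnemannFOCS2015, Lemma 5.2] -/
theorem length_coordX : oneX.length = 5 ∧ zeroX.length = 5 := ⟨rfl, rfl⟩

/-- … and three ones each. [cite: BringmannKunnemannFOCS2015, Lemma 5.2] -/
theorem count_true_coordX : oneX.count true = 3 ∧ zeroX.count true = 3 := ⟨rfl, rfl⟩

/-- The `y`-side coordinate values have equal type: length `5` … [cite: BringmannKunnemannFOCS2015, Lemma 5.2] -/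
theorem length_coordY : oneY.length = 5 ∧ zeroY.length = 5 := ⟨rfl, rfl⟩

/-- … and three ones each. [cite: BringmannKunnemannFOCS2015, Lemma 5.2] -/
theorem count_true_coordY : oneY.count true = 3 ∧ zeroY.count true = 3 := ⟨rfl, rfl⟩

/-! ### The alignment gadget (BK15, Lemma 5.3) for `c_subst = 1` -/

/-- The data the alignment gadget depends on (Bringmann–Künnemann, FOCS 2015, Lemma 5.3 and
Def. 3.1): the common type `t_x = (ℓₓ, sₓ)` (length, number of ones) of the inputs `x₁, …, x_n`
and the common length `ℓ_y` of the inputs `y₁, …, y_m` (their number of ones is not needed).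
[cite: BringmannKunnemannFOCS2015, Lemma 5.3] -/
structure Params where
  /-- Common length `ℓₓ` of the `xᵢ`. -/
  ℓx : ℕ
  /-- Common length `ℓ_y` of the `yⱼ`. -/
  ℓy : ℕ
  /-- Common number of ones `sₓ` of the `xᵢ`. -/
  sx : ℕ

namespace Params

variable (P : Params)

/-- `γ₁ := 10ρ(ℓₓ + ℓ_y)` with `ρ = 2⌈1/c_subst⌉ = 2` (BK15, Lemma 5.3), i.e. `20(ℓₓ + ℓ_y)`.
[cite: BringmannKunnemannFOCS2015, Lemma 5.3] -/
def γ₁ : ℕ := 20 * (P.ℓx + P.ℓy)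

/-- `γ₂ := 6ργ₁ + 5sₓ - ℓₓ = 12γ₁ + 5sₓ - ℓₓ` (BK15, Lemma 5.3), written without subtraction as
`239ℓₓ + 240ℓ_y + 5sₓ` (see `γ₂_add_ℓx`). [cite: BringmannKunnemannFOCS2015, Lemma 5.3] -/
def γ₂ : ℕ := 239 * P.ℓx + 240 * P.ℓy + 5 * P.sx

/-- `γ₃ := 2γ₂` (BK15, Lemma 5.3). [cite: BringmannKunnemannFOCS2015, Lemma 5.3] -/
def γ₃ : ℕ := 2 * P.γ₂

/-- `γ₄ := 4ργ₁ + ℓₓ = 8γ₁ + ℓₓ`, the length of `G(xᵢ)` (BK15, proof of Lemma 5.4).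
[cite: BringmannKunnemannFOCS2015, Lemma 5.4 (proof)] -/
def γ₄ : ℕ := 8 * P.γ₁ + P.ℓx

/-- `γ₂` is the printed `6ργ₁ + 5sₓ - ℓₓ`: `γ₂ + ℓₓ = 12γ₁ + 5sₓ`. [cite: BringmannKunnemannFOCS2015, Lemma 5.3] -/
theorem γ₂_add_ℓx : P.γ₂ + P.ℓx = 12 * P.γ₁ + 5 * P.sx := by
  simp only [γ₂, γ₁]; ring

/-- `γ₄ + γ₂ = 5 · (4γ₁ + sₓ)` (so `β(γ₄ + γ₂) = 4(4γ₁ + sₓ)` is an integer for `β = 4/5`).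
[cite: BringmannKunnemannFOCS2015, Lemma 5.4 (proof)] -/
theorem γ₄_add_γ₂ : P.γ₄ + P.γ₂ = 5 * (4 * P.γ₁ + P.sx) := by
  simp only [γ₄, γ₂, γ₁]; ring

/-- The guarding `G(z) := (1^{γ₁} 0^{γ₁})^ρ z (0^{γ₁} 1^{γ₁})^ρ` with `ρ = 2` (BK15, Lemma 5.3).
[cite: BringmannKunnemannFOCS2015, Lemma 5.3] -/
def guard (z : List Bool) : List Bool :=
  ones P.γ₁ ++ zeros P.γ₁ ++ ones P.γ₁ ++ zeros P.γ₁ ++ z ++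
    (zeros P.γ₁ ++ ones P.γ₁ ++ zeros P.γ₁ ++ ones P.γ₁)

/-- The first string of the alignment gadget, `x := G(x₁) 0^{γ₂} G(x₂) 0^{γ₂} ⋯ 0^{γ₂} G(x_n)`
(BK15, Lemma 5.3). [cite: BringmannKunnemannFOCS2015, Lemma 5.3] -/
def gadgetX (xs : List (List Bool)) : List Bool :=
  List.intercalate (zeros P.γ₂) (xs.map P.guard)

/-- The second string of the alignment gadget,
`y := 0^{nγ₃} G(y₁) 0^{γ₂} G(y₂) ⋯ 0^{γ₂} G(y_m) 0^{nγ₃}` (BK15, Lemma 5.3; `n` is the number of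
`xᵢ`). [cite: BringmannKunnemannFOCS2015, Lemma 5.3] -/
def gadgetY (n : ℕ) (ys : List (List Bool)) : List Bool :=
  zeros (n * P.γ₃) ++ List.intercalate (zeros P.γ₂) (ys.map P.guard) ++ zeros (n * P.γ₃)

/-- The offset `C := 2nγ₃ - β(n-m)(γ₄+γ₂)` with `β = 1 - c_subst/5 = 4/5` (BK15, proof of
Lemma 5.4), i.e. `4nγ₂ - 4(n-m)(4γ₁+sₓ)` by `γ₄_add_γ₂`; for `m ≤ n` the subtraction does not
truncate (`C_add`). [cite: BringmannKunnemannFOCS2015, Lemma 5.4 (proof)] -/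
def C (n m : ℕ) : ℕ := 4 * n * P.γ₂ - 4 * (n - m) * (4 * P.γ₁ + P.sx)

/-- `4(n-m)(4γ₁+sₓ) ≤ 4nγ₂`, so `C` is a genuine difference: `C + 4(n-m)(4γ₁+sₓ) = 4nγ₂`. [folklore] -/
theorem C_add (n m : ℕ) : P.C n m + 4 * (n - m) * (4 * P.γ₁ + P.sx) = 4 * n * P.γ₂ := by
  have h1 : 4 * P.γ₁ + P.sx ≤ P.γ₂ := by simp only [γ₁, γ₂]; omega
  have h2 : 4 * (n - m) * (4 * P.γ₁ + P.sx) ≤ 4 * n * P.γ₂ :=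
    Nat.mul_le_mul (by omega) h1
  simp only [C]; omega

/-- `|G(z)| = 8γ₁ + |z|`; in particular `|G(xᵢ)| = γ₄`. [cite: BringmannKunnemannFOCS2015, Lemma 5.4 (proof)] -/
@[simp] theorem length_guard (z : List Bool) : (P.guard z).length = 8 * P.γ₁ + z.length := by
  simp only [guard, List.length_append, length_ones, length_zeros]; ring

/-- `G(z)` has `4γ₁ + #₁(z)` ones. [folklore] -/
@[simp] theorem count_true_guard (z : List Bool) :
    (P.guard z).count true = 4 * P.γ₁ + z.count true := by
  simp only [guard, List.count_append, count_true_ones, count_true_zeros]; ring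

/-- Length of the first gadget string: `|x| = ∑ |G(xᵢ)| + (n-1)γ₂`, here for inputs of a common
length `ℓ`: `|x| = n(8γ₁ + ℓ) + (n-1)γ₂`. [folklore] -/
theorem length_gadgetX {ℓ : ℕ} (xs : List (List Bool)) (h : ∀ z ∈ xs, z.length = ℓ) :
    (P.gadgetX xs).length = xs.length * (8 * P.γ₁ + ℓ) + (xs.length - 1) * P.γ₂ := by
  induction xs with
  | nil => simp [gadgetX]
  | cons z xs ih =>
      have hz : z.length = ℓ := h z (by simp)
      have h' : ∀ w ∈ xs, w.length = ℓ := fun w hw => h w (by simp [hw])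
      rcases xs with _ | ⟨w, xs⟩
      · simp [gadgetX, hz]
      · have ih' := ih h'
        simp only [gadgetX, List.map_cons, List.intercalate_cons_cons, List.length_append,
          length_guard, length_zeros, List.length_cons] at ih' ⊢
        rw [ih', hz]
        simp only [Nat.add_sub_cancel]
        ring

/-- Length of the second gadget string for inputs of a common length `ℓ`:
`|y| = 2nγ₃ + m(8γ₁ + ℓ) + (m-1)γ₂`. [folklore] -/
theorem length_gadgetY {ℓ : ℕ} (n : ℕ) (ys : List (List Bool)) (h : ∀ z ∈ ys, z.length = ℓ) :
    (P.gadgetY n ys).length =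
      2 * (n * P.γ₃) + (ys.length * (8 * P.γ₁ + ℓ) + (ys.length - 1) * P.γ₂) := by
  have := P.length_gadgetX ys h
  simp only [gadgetX] at this
  simp only [gadgetY, List.length_append, length_zeros, this]
  ring

end Params

/-! ### Alignments and their cost (BK15, §3) -/

/-- A (partial) **alignment** of `[m]` into `[n]` (Bringmann–Künnemann, FOCS 2015, §3): a list of
pairs `(i₁,j₁), …, (i_k,j_k)` with `i₁ < ⋯ < i_k < n` and `j₁ < ⋯ < j_k < m` (0-based; hence
`k ≤ m`). [cite: BringmannKunnemannFOCS2015, §3 (Alignments)] -/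
def IsAlignment {n m : ℕ} (A : List (Fin n × Fin m)) : Prop :=
  A.Pairwise fun p q => p.1 < q.1 ∧ p.2 < q.2

/-- Being an alignment is decidable (it is a `List.Pairwise` condition). [folklore] -/
instance {n m : ℕ} (A : List (Fin n × Fin m)) : Decidable (IsAlignment A) :=
  inferInstanceAs (Decidable (A.Pairwise fun p q => p.1 < q.1 ∧ p.2 < q.2))

/-- `maxᵢⱼ δ(xᵢ, yⱼ)`, the punishment for an unaligned `j` (BK15, §3; `0` if `n = 0` or `m = 0`).
[cite: BringmannKunnemannFOCS2015, §3 (Alignments)] -/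
def maxDist {n m : ℕ} (x : Fin n → List Bool) (y : Fin m → List Bool) : ℕ :=
  Finset.univ.sup fun p : Fin n × Fin m => editDist (x p.1) (y p.2)

/-- The **cost of an alignment** `A` w.r.t. `x₁…x_n`, `y₁…y_m` (BK15, §3):
`δ(A) = ∑_{(i,j) ∈ A} δ(xᵢ,yⱼ) + (m - |A|) · maxᵢⱼ δ(xᵢ,yⱼ)` with `δ = editDist`.
[cite: BringmannKunnemannFOCS2015, §3 (Alignments)] -/
def alignCost {n m : ℕ} (x : Fin n → List Bool) (y : Fin m → List Bool)
    (A : List (Fin n × Fin m)) : ℕ :=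
  (A.map fun p => editDist (x p.1) (y p.2)).sum + (m - A.length) * maxDist x y

/-- The cost of the **structured alignment** `{(Δ+1,1),…,(Δ+m,m)}`, `0 ≤ Δ ≤ n - m` (BK15, §3),
i.e. `∑_{j<m} δ(x_{Δ+j}, yⱼ)` (no unaligned `j`). [cite: BringmannKunnemannFOCS2015, §3 (Alignments)] -/
def structuredCost {n m : ℕ} (x : Fin n → List Bool) (y : Fin m → List Bool) (Δ : ℕ)
    (hΔ : Δ + m ≤ n) : ℕ :=
  ∑ j : Fin m, editDist (x ⟨Δ + j, by omega⟩) (y j)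

/-- Every summand is at most the punishment term: `δ(xᵢ,yⱼ) ≤ maxDist x y`. [folklore] -/
theorem editDist_le_maxDist {n m : ℕ} (x : Fin n → List Bool) (y : Fin m → List Bool)
    (i : Fin n) (j : Fin m) : editDist (x i) (y j) ≤ maxDist x y :=
  Finset.le_sup (f := fun p : Fin n × Fin m => editDist (x p.1) (y p.2)) (Finset.mem_univ (i, j))

/-! ### Lemma 5.4 as a named fact -/

/-- **The alignment gadget for Levenshtein distance on binary strings (named fact;
Bringmann–Künnemann, FOCS 2015, Lemma 5.4 with Lemma 5.3, `c_subst = 1`).** Let `1 ≤ m ≤ n`,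
let `x₁, …, x_n` be bit strings of one type `(ℓₓ, sₓ)` (length `ℓₓ`, `sₓ` ones) and `y₁, …, y_m`
bit strings of one length `ℓ_y ≥ ℓₓ`, let `P = (ℓₓ, ℓ_y, sₓ)` and
`x = G(x₁) 0^{γ₂} ⋯ G(x_n)`, `y = 0^{nγ₃} G(y₁) 0^{γ₂} ⋯ G(y_m) 0^{nγ₃}`, `C = 2nγ₃ - β(n-m)(γ₄+γ₂)`
(`Params.gadgetX/gadgetY/C`). Then `(x, y, C)` realises an alignment gadget (BK15, Def. 3.1):
(i) for every structured alignment, `editDist x y ≤ C + ∑_{j<m} editDist x_{Δ+j} yⱼ`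
(`0 ≤ Δ ≤ n-m`); (ii) there is an alignment `A ∈ 𝒜_{n,m}` with
`C + (∑_{(i,j)∈A} editDist xᵢ yⱼ + (m-|A|) maxᵢⱼ editDist xᵢ yⱼ) ≤ editDist x y`.
Printed proof: (i) partition `x` along `y`'s blocks following the structured alignment and use
Lemma 5.8 (`editDist (x', 0^{nγ₃}) = nγ₃ - β|x'|` for prefixes `x'` of the special form) and
greedy matching of the guards; (ii) split an optimal traversal along `y`'s blocks (Fact 5.7),
align `j` with the `i` whose `xᵢ` lies in the piece facing `G(yⱼ)`, and bound each piece from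
below (Claim 5.9, Lemma 5.8, Fact 5.5(2)). **Scope:** the side conditions `1 ≤ m`, one common
`ℓ_y`, and `ℓₓ ≤ ℓ_y` are discussed in the module docstring ("Scope of the named fact"); they hold
in all uses of the lemma in BK15 §3.1. [cite: BringmannKunnemannFOCS2015, Lemma 5.4 (with Lemma 5.3, Def. 3.1)] -/
def alignmentGadget_editDist : Prop :=
  ∀ (n m : ℕ) (P : Params) (x : Fin n → List Bool) (y : Fin m → List Bool),
    1 ≤ m → m ≤ n → P.ℓx ≤ P.ℓy →
    (∀ i, (x i).length = P.ℓx) → (∀ i, (x i).count true = P.sx) → (∀ j, (y j).length = P.ℓy) →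
    (∀ (Δ : ℕ) (hΔ : Δ + m ≤ n),
        editDist (P.gadgetX (List.ofFn x)) (P.gadgetY n (List.ofFn y)) ≤
          P.C n m + structuredCost x y Δ hΔ) ∧
    (∃ A : List (Fin n × Fin m), IsAlignment A ∧
        P.C n m + alignCost x y A ≤ editDist (P.gadgetX (List.ofFn x)) (P.gadgetY n (List.ofFn y)))

end BKGadget

end Literature.Computability.FineGrained
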